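import Literature.AlgebraicGeometry.Frobenioids.Birationalization
import Mathlib.CategoryTheory.Limits.Shapes.Pullback.Cospan
import HarnessLib

/-!
# Frobenioids I, Proposition 1.11 (vii) as the square-completion hypothesis `HasBiratSquares F`
# (FACT-LIST F-0949): the universal closure over bare pre-Frobenioid structures is REFUTABLE

Mochizuki, *The geometry of Frobenioids I: the general theory*, Kyushu J. Math. **62** (2008)
293–400, §1, Proposition 1.11 (vii), kurims text p. 37, and its use in the proof of Proposition 4.4
(i), p. 84 l. 3 ("it follows from Proposition 1.11, (vii), that there exists a commutative diagram …
where `α′` is a co-angular pre-step") [cite: MochizukiFrdI2008, Prop. 1.11(vii) p.37]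
[cite: MochizukiFrdI2008, Prop. 4.4(i) p.84].

Negative knowledge recorded next to `Birationalization.lean` (abc-iut-L1; FACT-LIST row **F-0949**
`PreFrobenioid.HasBiratSquares`, class `preparatory`, kernel_closedness `parametrised`, label
«universal-closure REFUTED / schema; instance forms model-witnessed» carried so far WITHOUT a kernel
object for the refutation — R7 TYPE-audit abc-iut-w5-d199), PROOF-ONLY (no definitions, no instances,
no notation), abc-iut cell seat abc-iut-f-025.

`HasBiratSquares F` is the HYPOTHESIS under which `Birationalization.lean` composes birational
fractions: for every morphism `φ : X → B` and co-angular pre-step `β : B′ → B` there are a co-angular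
pre-step `α′ : X′ → X` and a morphism `φ″ : X′ → B′` with `α′ ≫ φ = φ″ ≫ β`.  Print proves it for every
FROBENIOID (Prop. 1.11 (vii)), and so does the tree, in that generality:
`PreFrobenioid.hasBiratSquares_of_isFrobenioid (hF : IsFrobenioid F) : HasBiratSquares F`
(`BiratLocalization.lean`, abc-iut-L6-t6), with the model instances `Ex63_hasBiratSquares`,
`Thm62_hasBiratSquares`, `PadicFrd.Datum.hasBiratSquares`, `hasBiratSquares_untr`.  The typed predicate,
however, is stated for an ARBITRARY pre-Frobenioid structure functor `F : C ⥤ F_Φ` (no axiom of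
Def. 1.3), and its universal closure is false.  Witness (all data at universe `0`): the base is the
one-morphism category `𝟙 = Discrete PUnit` with the divisor monoid `Φ_ℕ := constMonoidOn (Multiplicative ℕ)`
([FrdI] Def. 1.1 (iii)); `C := WalkingCospan` (`left → one ← right`, Mathlib); and
`F := cospan (𝟙 ⋆) (id, 1, 1) : C ⥤ F_{Φ_ℕ}` sends `inl` to the identity of the unique object `⋆` and
`inr` to the linear base-identity endomorphism of `⋆` with divisor `1 ∈ ℕ` (multiplicatively
`ofAdd 1`).  Then

* `isCoAngularPreStep_cospan_inr` — `inr : right → one` is a co-angular pre-step: it is linear and a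
  base-isomorphism, and in the only factorisation `inr = id ≫ inr ≫ id` whose middle term is not an
  identity the middle term `inr` is not isometric (`Div = ofAdd 1 ≠ 1`);
* `not_hasBiratSquares_cospan` — no square completes `(inl, inr)`: the only arrow into `left` is its
  identity and there is no arrow `left → right`;
* `PreFrobenioid.not_forall_hasBiratSquares` — hence the fully quantified closure is refuted (F-0949).

So the row is admissible ONLY in instance form / under `IsFrobenioid F` (where it is a THEOREM of the
tree).  Elementary; nothing here bears on the disputed [IUTchIII] Cor. 3.12 or takes a side; refuting
the closure of OUR typing is not a statement about print.
-/

namespace Literature.AlgebraicGeometry.Frobenioids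

open CategoryTheory CategoryTheory.Limits Opposite

namespace PreFrobenioid

/-! ### The witness: the cospan-shaped pre-Frobenioid structure over `F_{Φ_ℕ}` -/

/-- In the cospan-shaped pre-Frobenioid structure `F = cospan (𝟙 ⋆) (id, 1, 1) : WalkingCospan ⥤ F_{Φ_ℕ}`
the arrow `inr : right → one` is a co-angular pre-step: linear, base-isomorphic (the base is the
one-morphism category), and co-angular because its image has non-zero divisor, so that the unique
non-trivial factorisation `id ≫ inr ≫ id` has a non-isometric middle term.
[cite: MochizukiFrdI2008, Def. 1.3(iii) p.24] -/
theorem isCoAngularPreStep_cospan_inr :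
    IsCoAngularPreStep
      (cospan (𝟙 (ElemFrobenioid.of (constMonoidOn (Multiplicative ℕ)) (Discrete.mk PUnit.unit)))
        (ElemFrobenioid.homMk
          (A := ElemFrobenioid.of (constMonoidOn (Multiplicative ℕ)) (Discrete.mk PUnit.unit))
          (B := ElemFrobenioid.of (constMonoidOn (Multiplicative ℕ)) (Discrete.mk PUnit.unit))
          (𝟙 _) (Multiplicative.ofAdd (1 : ℕ) : Multiplicative ℕ) 1))
      WalkingCospan.Hom.inr := by
  refine ⟨?_, ?_, ?_⟩
  · -- co-angular: case analysis on the factorisations `γ ≫ β ≫ α = inr`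
    intro X Y γ β α _ _ hiso _ _
    cases γ with
    | id _ =>
      cases β with
      | id _ => exact (inferInstance : IsIso (𝟙 WalkingCospan.right))
      | term _ =>
        -- `β = inr` is not isometric: `Div = ofAdd 1 ≠ ofAdd 0`
        exfalso
        have h : (Multiplicative.ofAdd (1 : ℕ) : Multiplicative ℕ) = Multiplicative.ofAdd (0 : ℕ) := hiso
        exact absurd (Multiplicative.ofAdd.injective h) one_ne_zero
    | term _ =>
      cases β with
      | id _ => exact (inferInstance : IsIso (𝟙 WalkingCospan.one))
  · -- linear
    show ElemFrobenioid.degFr (ElemFrobenioid.homMk _ _ _) = 1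
    rfl
  · -- base-isomorphism
    show IsIso (ElemFrobenioid.Base (ElemFrobenioid.homMk _ _ _))
    exact (inferInstance : IsIso (𝟙 (Discrete.mk PUnit.unit : Discrete PUnit.{1})))

/-- **F-0949, a pre-Frobenioid structure WITHOUT birational squares:** in the cospan-shaped structure
the pair `(inl : left → one, inr : right → one)` — `inr` a co-angular pre-step — admits no completion
`α′ ≫ inl = φ″ ≫ inr`: the only arrow into `left` is its identity and there is no arrow `left → right`.
[cite: MochizukiFrdI2008, Prop. 4.4(i) p.84] -/
theorem not_hasBiratSquares_cospan :
    ¬ HasBiratSquares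
      (cospan (𝟙 (ElemFrobenioid.of (constMonoidOn (Multiplicative ℕ)) (Discrete.mk PUnit.unit)))
        (ElemFrobenioid.homMk
          (A := ElemFrobenioid.of (constMonoidOn (Multiplicative ℕ)) (Discrete.mk PUnit.unit))
          (B := ElemFrobenioid.of (constMonoidOn (Multiplicative ℕ)) (Discrete.mk PUnit.unit))
          (𝟙 _) (Multiplicative.ofAdd (1 : ℕ) : Multiplicative ℕ) 1)) := by
  intro h
  obtain ⟨X', α', φ'', -, -⟩ := h WalkingCospan.Hom.inl WalkingCospan.Hom.inr isCoAngularPreStep_cospan_inr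
  cases α' with
  | id _ => cases φ''

end PreFrobenioid

/-! ### The fully quantified closure, refuted at the cospan-shaped structure -/

/-- **FACT-LIST F-0949, universal closure REFUTED** (witness: `C = WalkingCospan`,
`F = cospan (𝟙 ⋆) (id, 1, 1) : C ⥤ F_{Φ_ℕ}` over the one-morphism base, the pair `(inl, inr)`).  The
consumed form — `HasBiratSquares F` for a FROBENIOID, [FrdI] Prop. 1.11 (vii) — is the theorem
`PreFrobenioid.hasBiratSquares_of_isFrobenioid` of the tree. [cite: MochizukiFrdI2008, Prop. 1.11(vii) p.37] -/
theorem PreFrobenioid.not_forall_hasBiratSquares :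
    ¬ ∀ (D : Type) [Category.{0} D] (Φ : Dᵒᵖ ⥤ CommMonCat.{0}) (C : Type) [Category.{0} C]
        (F : C ⥤ ElemFrobenioid Φ),
        Literature.AlgebraicGeometry.Frobenioids.PreFrobenioid.HasBiratSquares F :=
  fun h => PreFrobenioid.not_hasBiratSquares_cospan (h _ _ _ _)

end Literature.AlgebraicGeometry.Frobenioids
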